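/-
Copyright (c) 2026 the pub-hodgecm-mathlib formalisation cell (harness21).  Prover seat hodgecm-mathlib-R90-C133-p01 (g3), R90-TF section S5
(Rogawski Ch. 13.3); brick (N3b) of the Literature road to S5-C's socket `stub_R90_S5_excPS_notUnitarizable` (census (H29)
`CENSUS-D-REMAINDER.md` 990a3cc665ef2629 §4 R6-2; verdict (H31); default card (α) announced 2026-09-05T04:0xZ).
-/
import Summits.HodgeConjecture.HodgeConjecture.Theorems.F0P3cU2PrincipalSeriesJacquetFiltration   -- ★ `u2PrincipalSeries_jacquetFiltration` (dim 2, `wχ`-line, quotient `χ`)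
import Literature.NumberTheory.Automorphic.JacquetLineExponents                                  -- ★ `HasJacquetExponent.eq_or_eq_of_line`
import HarnessLib

/-!
# R90-TF · S5 — `R90S5U2PrincipalSeriesTwoExponents`: BOTH Jacquet exponents of the principal series `i(χ₁, χ₂)` of `U(Φ₂)(L⁺_v)` at a non-split
# place, as ★ `Representation.HasJacquetExponent` — `wχ = (χ̄₁⁻¹, χ₂)` always, `χ` itself whenever `χ ≠ wχ` — and «no other exponent»

Cell `hodgecm-mathlib`, crux H413 (`stmt-HodgeConjecture-24833`), route of record `HCCMUnconditional`; programme R90-TF (HUMAN RULING «R90-TF SLAB —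
MAX PUSH»), section S5 (Rogawski Ch. 13.3, base `R90-C133`); seat R90-C133-p01 (g3), brick (N3b).  THEOREMS ONLY: no definition, no instance, no
notation, no named fact, no `sorry`; imports ★ `Theorems` + ★ Literature only; `--supports stmt-HodgeConjecture-24833` (helper).  Namespace `…R90.S5`.

WHY.  ★ ED. 2 of `R90S5UnitarizableRayEigenvalueBound` bounds every Jacquet EXPONENT of a unitarizable admissible representation along a ray
(`norm_rootDeltaChar_mul_exponent_le_one`, hypothesis `hχ : ρ.HasJacquetExponent t χ′`).  For the excluded principal series `i((‖·‖_E^{±1}μ⁻¹, χ₂))` of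
S5-C :486 the consumer needs the exponent of modulus `δ^{-1}` AS a `HasJacquetExponent` — i.e. BOTH exponents of `i(χ)`, not only the `wχ`-line.  The tree's
★ `F0P3cU2PrincipalSeriesJacquetFiltration.u2PrincipalSeries_jacquetFiltration` ([Casselman1995, Lemma 7.1.1 (a)] for `U(1,1)`) gives `dim r_{B₂} i(χ) = 2`, a
`T₂`-LINE `ℓ` with character `wχ` and the QUOTIENT character `χ`; this file turns that into eigenvectors:

* §1 (generic linear algebra over ★ `Representation.normalizedJacquet`, any `G`, any parabolic triple `t` with `M` acting through commuting operators):
  `hasJacquetExponent_of_stableLine` — a non-zero stable line with character `θ₁` gives the exponent `θ₁`;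
  **`hasJacquetExponent_quot_of_line_of_ne`** — if moreover `M` acts by `θ₂` modulo `ℓ`, `ℓ ≠ ⊤`, `M` is commutative and `θ₁ m₀ ≠ θ₂ m₀` for ONE
  `m₀`, then `θ₂` is an exponent too: for `y ∉ ℓ` the vector `w := r(m₀) y − θ₁(m₀) y` is non-zero (`≡ (θ₂ − θ₁)(m₀)·y mod ℓ`) and `r(m) w = θ₂(m) w`
  (write `r(m) y = θ₂(m) y + l_m`, `l_m ∈ ℓ`, and commute `r(m)` past `r(m₀)`).  No dimension hypothesis.
* §2 (the CM instance at a NON-SPLIT `v`, continuous `χ₁ χ₂`): **`hasJacquetExponent_weyl_cmPrincipalSeries_two`** (`wχ`, unconditionally),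
  **`hasJacquetExponent_self_cmPrincipalSeries_two`** (`χ`, given ONE torus element `m₀` with `wχ m₀ ≠ χ m₀` — e.g. any `d(α, ᾱ⁻¹)` with `‖α‖ ≠ 1`
  when `|χ₁| = ‖·‖_E^{±1}`), and `hasJacquetExponent_cmPrincipalSeries_two_iff` (REGULAR case: the exponents are EXACTLY `{wχ, χ}`, ★
  `HasJacquetExponent.eq_or_eq_of_line`).  Commutativity of `T₂` = ★ `torusU_mul_comm`.
HONEST LABEL: this file pays no socket by itself (brick (N3b); the remaining bricks of C :486's road are (N3c) the Iwahori datum of `U(Φ₂)_v` and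
(N1) irreducibility off Keys' points); HC_CM is proved only modulo the 7 printed citations (2 remaining named inputs: hLiu418 =
`stmt-HodgeConjecture-24832`, h413 = `stmt-HodgeConjecture-24833`) until rung 0 closes.

## References
* [Casselman1995] W. Casselman, *Introduction to the theory of admissible representations of `p`-adic reductive groups* (draft 1 May 1995), §6.4
  Prop. 6.4.1, §7.1 Lemma 7.1.1 (a) p. 67 («`0 → (w⁻¹σ)δ^{1/2} → I_N → σδ^{1/2} → 0`»), §4.4 p. 45 (exponents).
* [BernsteinZelevinsky1977] I. N. Bernstein, A. V. Zelevinsky, Ann. Sci. ÉNS 10 (1977), §2.12 Geometrical Lemma, Cor. 2.13 (c).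
* [Rogawski1990] J. D. Rogawski, *Automorphic Representations of Unitary Groups in Three Variables*, Ann. of Math. Stud. 123 (1990), §12.1 p. 171,
  §12.2 p. 173 («`w(χ₁, χ₂) = (χ̄₁⁻¹, χ₂)`»), §13.1 p. 199 ¶3 (the consumer statement).
-/

set_option autoImplicit false
-- the mandated namespace repeats the single-problem summit's segment (`HodgeConjecture.HodgeConjecture`)
set_option linter.dupNamespace false

open Literature.NumberTheory Literature.NumberTheory.Automorphic Literature.NumberTheory.Automorphic.UnitaryGroup
open Summit.HodgeConjecture.HodgeConjecture.Cruxes.H413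
open _root_.NumberField _root_.IsDedekindDomain
open scoped MatrixGroups

namespace Summit.HodgeConjecture.HodgeConjecture.R90.S5

/-! ## §1 Generic: exponents from a stable line and from the quotient character -/

section Generic

variable {G V : Type*} [Group G] [TopologicalSpace G] [IsTopologicalGroup G] [AddCommGroup V] [Module ℂ V]
  {ρ : Representation ℂ G V} (t : ParabolicTriple G) [LocallyCompactSpace ↥t.P]

/-- **A non-zero stable line with character `θ₁` gives the exponent `θ₁`.** [cite: Casselman1995, §4.4 p. 45, Prop. 6.4.1] -/
theorem hasJacquetExponent_of_stableLine {θ₁ : ↥t.M →* ℂˣ} (ℓ : Submodule ℂ (t.restrict ρ).Coinvariants) (hℓ0 : ℓ ≠ ⊥)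
    (hℓ : ∀ (m : ↥t.M), ∀ x ∈ ℓ, ρ.normalizedJacquet t m x = ((θ₁ m : ℂˣ) : ℂ) • x) :
    ρ.HasJacquetExponent t θ₁ := by
  obtain ⟨x, hxℓ, hx0⟩ := (Submodule.ne_bot_iff ℓ).1 hℓ0
  exact ⟨x, hx0, fun m => hℓ m x hxℓ⟩

/-- **The quotient character is an exponent in the REGULAR case.**  Let `ℓ` be a stable submodule of the normalised Jacquet module on which `M` acts
by `θ₁`, suppose `M` acts by `θ₂` modulo `ℓ` (`r(m) x − θ₂(m) x ∈ ℓ`), that `ℓ ≠ ⊤`, that `M` is commutative (so the `r(m)` pairwise commute), and that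
`θ₁ m₀ ≠ θ₂ m₀` for one `m₀`.  Then `θ₂` is an exponent: for `y ∉ ℓ`, `w := r(m₀) y − θ₁(m₀) y` is non-zero and `r(m) w = θ₂(m) w` for all `m`.
[cite: Casselman1995, Prop. 6.4.1, Lemma 7.1.1 (a)] [cite: BernsteinZelevinsky1977, Cor. 2.13 (c)] -/
theorem hasJacquetExponent_quot_of_line_of_ne {θ₁ θ₂ : ↥t.M →* ℂˣ} (ℓ : Submodule ℂ (t.restrict ρ).Coinvariants) (hℓtop : ℓ ≠ ⊤)
    (hℓ : ∀ (m : ↥t.M), ∀ x ∈ ℓ, ρ.normalizedJacquet t m x = ((θ₁ m : ℂˣ) : ℂ) • x)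
    (hq : ∀ (m : ↥t.M) (x : (t.restrict ρ).Coinvariants), ρ.normalizedJacquet t m x - ((θ₂ m : ℂˣ) : ℂ) • x ∈ ℓ)
    (hMc : ∀ a b : ↥t.M, a * b = b * a) {m₀ : ↥t.M} (hne : θ₁ m₀ ≠ θ₂ m₀) :
    ρ.HasJacquetExponent t θ₂ := by
  -- `M` commutative ⇒ the operators `r(m)` commute
  have hcomm : ∀ (m m' : ↥t.M) (x : (t.restrict ρ).Coinvariants),
      ρ.normalizedJacquet t m (ρ.normalizedJacquet t m' x) = ρ.normalizedJacquet t m' (ρ.normalizedJacquet t m x) := by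
    intro m m' x
    show (ρ.normalizedJacquet t m * ρ.normalizedJacquet t m') x = (ρ.normalizedJacquet t m' * ρ.normalizedJacquet t m) x
    rw [← map_mul, ← map_mul, hMc]
  -- a vector outside `ℓ`
  obtain ⟨y, -, hyℓ⟩ := SetLike.exists_of_lt (lt_top_iff_ne_top.2 hℓtop)
  set w : (t.restrict ρ).Coinvariants := ρ.normalizedJacquet t m₀ y - ((θ₁ m₀ : ℂˣ) : ℂ) • y with hw
  -- `w ≡ (θ₂ − θ₁)(m₀) • y  (mod ℓ)`, hence `w ∉ ℓ`, in particular `w ≠ 0`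
  have hwy : w - (((θ₂ m₀ : ℂˣ) : ℂ) - ((θ₁ m₀ : ℂˣ) : ℂ)) • y ∈ ℓ := by
    have h := hq m₀ y
    have heq : w - (((θ₂ m₀ : ℂˣ) : ℂ) - ((θ₁ m₀ : ℂˣ) : ℂ)) • y = ρ.normalizedJacquet t m₀ y - ((θ₂ m₀ : ℂˣ) : ℂ) • y := by
      rw [hw, sub_smul]; abel
    rw [heq]
    exact h
  have hc : ((θ₂ m₀ : ℂˣ) : ℂ) - ((θ₁ m₀ : ℂˣ) : ℂ) ≠ 0 :=
    fun h0 => hne (Units.val_injective (sub_eq_zero.1 h0)).symm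
  have hw0 : w ≠ 0 := by
    intro h0
    apply hyℓ
    rw [h0, zero_sub] at hwy
    have h1 := ℓ.smul_mem (-(((θ₂ m₀ : ℂˣ) : ℂ) - ((θ₁ m₀ : ℂˣ) : ℂ))⁻¹) hwy
    rwa [smul_neg, ← neg_smul, neg_neg, smul_smul, inv_mul_cancel₀ hc, one_smul] at h1
  refine ⟨w, hw0, fun m => ?_⟩
  -- `r(m) y = θ₂(m) y + l` with `l ∈ ℓ`
  set l := ρ.normalizedJacquet t m y - ((θ₂ m : ℂˣ) : ℂ) • y with hl
  have hlℓ : l ∈ ℓ := hq m y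
  have hy : ρ.normalizedJacquet t m y = ((θ₂ m : ℂˣ) : ℂ) • y + l := by rw [hl]; abel
  -- compute `r(m) w`
  calc ρ.normalizedJacquet t m w
      = ρ.normalizedJacquet t m₀ (ρ.normalizedJacquet t m y) - ((θ₁ m₀ : ℂˣ) : ℂ) • ρ.normalizedJacquet t m y := by
          rw [hw, map_sub, map_smul, hcomm]
    _ = ((θ₂ m : ℂˣ) : ℂ) • (ρ.normalizedJacquet t m₀ y - ((θ₁ m₀ : ℂˣ) : ℂ) • y) := by
          rw [hy, map_add, map_smul, hℓ m₀ l hlℓ]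
          module
    _ = ((θ₂ m : ℂˣ) : ℂ) • w := by rw [hw]

end Generic

/-! ## §2 The CM instance: the principal series of `U(Φ₂)(L⁺_v)` at a non-split place -/

section CM

variable (L : Type) [Field L] [NumberField L] [IsCMField L]

/-- **THE `wχ`-EXPONENT of `i(χ₁, χ₂)` on `U(Φ₂)(L⁺_v)`** (non-split `v`, continuous `χ₁ χ₂`): `wχ = (χ̄₁⁻¹, χ₂)` (★ `weylTorusCharPair`) is a Jacquet exponent —
the stable line of ★ `u2PrincipalSeries_jacquetFiltration` is non-zero (`finrank = 1`).
[cite: Casselman1995, Lemma 7.1.1 (a) p. 67] [cite: Rogawski1990, §12.2 p. 173] -/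
theorem hasJacquetExponent_weyl_cmPrincipalSeries_two (v : HeightOneSpectrum (𝓞 ↥(maximalRealSubfield L)))
    (hns : ∀ w : PlacesOver L v, IsCMField.complexConj L • w.1 = w.1)
    (χ₁ : (LocalRing L v)ˣ →* ℂˣ) (χ₂ : ↥(normOneUnits (conjLocal L (IsCMField.complexConj L) v)) →* ℂˣ)
    (h₁ : Continuous fun x => ((χ₁ x : ℂˣ) : ℂ)) (h₂ : Continuous fun x => ((χ₂ x : ℂˣ) : ℂ)) :
    haveI := locallyCompactSpace_cmBorelU L 2 v
    (cmPrincipalSeries L 2 v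
        (torusCharPair (conjLocal L (IsCMField.complexConj L) v) (cmLocalForm L 2 v) (cmLocalForm_eq_over L 2 v) 0 χ₁ χ₂)).HasJacquetExponent
      (cmBorelTriple L 2 v) (weylTorusCharPair (conjLocal L (IsCMField.complexConj L) v) (cmLocalForm L 2 v) (cmLocalForm_eq_over L 2 v) 0 χ₁ χ₂) := by
  haveI := locallyCompactSpace_cmBorelU L 2 v
  obtain ⟨_, _, ℓ, hℓ1, hℓ, -⟩ := F0P3cU2PrincipalSeriesJacquetFiltration.u2PrincipalSeries_jacquetFiltration L v hns χ₁ χ₂ h₁ h₂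
  refine hasJacquetExponent_of_stableLine (cmBorelTriple L 2 v) ℓ ?_ hℓ
  intro h0
  rw [h0, finrank_bot] at hℓ1
  exact zero_ne_one hℓ1

set_option maxHeartbeats 800000 in
-- the `whnf` of the `hreg`-instantiated statement on the `cmPrincipalSeries` carrier exceeds the default budget (★ `u2PrincipalSeries_jacquetFiltration` runs at 8 M)
/-- **THE `χ`-EXPONENT of `i(χ₁, χ₂)` on `U(Φ₂)(L⁺_v)` IN THE REGULAR CASE** (non-split `v`, continuous `χ₁ χ₂`): if `wχ m₀ ≠ χ m₀` for ONE torus element `m₀`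
(`χ₁(ᾱ)⁻¹ ≠ χ₁(α)` for one `d(α, ᾱ⁻¹)`; e.g. `|χ₁| = ‖·‖_E^{±1}` and `‖α‖ ≠ 1`), then `χ = (χ₁, χ₂)` (★ `torusCharPair`) is a Jacquet exponent of `i(χ)` —
§1 `hasJacquetExponent_quot_of_line_of_ne` on ★ `u2PrincipalSeries_jacquetFiltration` (`ℓ ≠ ⊤` as `finrank ℓ = 1 < 2`; `T₂` commutative, ★ `torusU_mul_comm`).
[cite: Casselman1995, Lemma 7.1.1 (a) p. 67, Prop. 6.4.1] [cite: Rogawski1990, §12.1 p. 171, §12.2 p. 173] -/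
theorem hasJacquetExponent_self_cmPrincipalSeries_two (v : HeightOneSpectrum (𝓞 ↥(maximalRealSubfield L)))
    (hns : ∀ w : PlacesOver L v, IsCMField.complexConj L • w.1 = w.1)
    (χ₁ : (LocalRing L v)ˣ →* ℂˣ) (χ₂ : ↥(normOneUnits (conjLocal L (IsCMField.complexConj L) v)) →* ℂˣ)
    (h₁ : Continuous fun x => ((χ₁ x : ℂˣ) : ℂ)) (h₂ : Continuous fun x => ((χ₂ x : ℂˣ) : ℂ))
    (hreg : ∃ m₀ : ↥(cmBorelTriple L 2 v).M,
      weylTorusCharPair (conjLocal L (IsCMField.complexConj L) v) (cmLocalForm L 2 v) (cmLocalForm_eq_over L 2 v) 0 χ₁ χ₂ m₀ ≠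
        torusCharPair (conjLocal L (IsCMField.complexConj L) v) (cmLocalForm L 2 v) (cmLocalForm_eq_over L 2 v) 0 χ₁ χ₂ m₀) :
    haveI := locallyCompactSpace_cmBorelU L 2 v
    (cmPrincipalSeries L 2 v
        (torusCharPair (conjLocal L (IsCMField.complexConj L) v) (cmLocalForm L 2 v) (cmLocalForm_eq_over L 2 v) 0 χ₁ χ₂)).HasJacquetExponent
      (cmBorelTriple L 2 v) (torusCharPair (conjLocal L (IsCMField.complexConj L) v) (cmLocalForm L 2 v) (cmLocalForm_eq_over L 2 v) 0 χ₁ χ₂) := by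
  haveI := locallyCompactSpace_cmBorelU L 2 v
  obtain ⟨hfd, h2, ℓ, hℓ1, hℓ, hq⟩ := F0P3cU2PrincipalSeriesJacquetFiltration.u2PrincipalSeries_jacquetFiltration L v hns χ₁ χ₂ h₁ h₂
  obtain ⟨m₀, hm₀⟩ := hreg
  haveI := hfd
  -- `ℓ ≠ ⊤`: `finrank ℓ = 1 ≠ 2 = finrank r(i(χ))`
  have hℓtop : ℓ ≠ ⊤ := by
    intro htop
    rw [htop] at hℓ1
    rw [finrank_top] at hℓ1
    omega
  -- the torus `T₂ = (cmBorelTriple L 2 v).M` is commutative (★ `torusU_mul_comm`; `borelTriple_M` is `rfl`)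
  exact hasJacquetExponent_quot_of_line_of_ne (cmBorelTriple L 2 v) ℓ hℓtop hℓ hq
    (torusU_mul_comm (conjLocal L (IsCMField.complexConj L) v) (cmLocalForm L 2 v)) hm₀

/-- **THE EXPONENTS OF `i(χ₁, χ₂)` ARE EXACTLY `{wχ, χ}` IN THE REGULAR CASE** (non-split `v`): `ψ` is a Jacquet exponent of `i(χ)` iff `ψ = wχ` or `ψ = χ`
(⇒ by ★ `HasJacquetExponent.eq_or_eq_of_line` on the filtration; ⇐ by the two theorems above). [cite: Casselman1995, Lemma 7.1.1 (a) p. 67, Prop. 6.4.1] -/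
theorem hasJacquetExponent_cmPrincipalSeries_two_iff (v : HeightOneSpectrum (𝓞 ↥(maximalRealSubfield L)))
    (hns : ∀ w : PlacesOver L v, IsCMField.complexConj L • w.1 = w.1)
    (χ₁ : (LocalRing L v)ˣ →* ℂˣ) (χ₂ : ↥(normOneUnits (conjLocal L (IsCMField.complexConj L) v)) →* ℂˣ)
    (h₁ : Continuous fun x => ((χ₁ x : ℂˣ) : ℂ)) (h₂ : Continuous fun x => ((χ₂ x : ℂˣ) : ℂ))
    (hreg : ∃ m₀ : ↥(cmBorelTriple L 2 v).M,
      weylTorusCharPair (conjLocal L (IsCMField.complexConj L) v) (cmLocalForm L 2 v) (cmLocalForm_eq_over L 2 v) 0 χ₁ χ₂ m₀ ≠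
        torusCharPair (conjLocal L (IsCMField.complexConj L) v) (cmLocalForm L 2 v) (cmLocalForm_eq_over L 2 v) 0 χ₁ χ₂ m₀)
    (ψ : ↥(cmBorelTriple L 2 v).M →* ℂˣ) :
    haveI := locallyCompactSpace_cmBorelU L 2 v
    (cmPrincipalSeries L 2 v
        (torusCharPair (conjLocal L (IsCMField.complexConj L) v) (cmLocalForm L 2 v) (cmLocalForm_eq_over L 2 v) 0 χ₁ χ₂)).HasJacquetExponent
      (cmBorelTriple L 2 v) ψ ↔
    ψ = weylTorusCharPair (conjLocal L (IsCMField.complexConj L) v) (cmLocalForm L 2 v) (cmLocalForm_eq_over L 2 v) 0 χ₁ χ₂ ∨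
      ψ = torusCharPair (conjLocal L (IsCMField.complexConj L) v) (cmLocalForm L 2 v) (cmLocalForm_eq_over L 2 v) 0 χ₁ χ₂ := by
  haveI := locallyCompactSpace_cmBorelU L 2 v
  constructor
  · intro hψ
    obtain ⟨-, -, ℓ, -, hℓ, hq⟩ := F0P3cU2PrincipalSeriesJacquetFiltration.u2PrincipalSeries_jacquetFiltration L v hns χ₁ χ₂ h₁ h₂
    exact Representation.HasJacquetExponent.eq_or_eq_of_line (cmBorelTriple L 2 v) ℓ hℓ hq hψ
  · rintro (rfl | rfl)
    · exact hasJacquetExponent_weyl_cmPrincipalSeries_two L v hns χ₁ χ₂ h₁ h₂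
    · exact hasJacquetExponent_self_cmPrincipalSeries_two L v hns χ₁ χ₂ h₁ h₂ hreg

end CM

end Summit.HodgeConjecture.HodgeConjecture.R90.S5
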